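import Summits.BirchSwinnertonDyer.BirchSwinnertonDyer.Theorems.BiquadraticEisensteinDescentHeegnerTwistCouplingInSupplySymbolicMonskyAuxLowerBoundTwins
import HarnessLib

set_option linter.dupNamespace false -- `Summit.BirchSwinnertonDyer.BirchSwinnertonDyer.Theorems.…` (summit = sub)
set_option autoImplicit false

/-!
# Crux `HeegnerTwistCouplingInSupply` (stmt-BirchSwinnertonDyer-21381) — lower bounds for the number of auxiliary primes: the SELMER bound
# `2t ≥ s* + 2` (w3 g20's «`t ≥ t₀ = s*/2 + 1`», now kernel-checked at general `k`)

Route `BiquadraticEisensteinDescent` (cell `pub/bsd-wall`, width seat `bsd-wall-cm-bed-w3` g21; `--supports` 21381, helper). Third file of the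
lower-bound layer (`…AuxLowerBound`: `t ≥ κ_u+1`; `…AuxLowerBoundTwins`: `t ≥ κ_w+1`, `t ≥ κ_v+1`).

THE STATEMENT (★ `card_add_two_le_two_mul_length_of_virtualKernel`). A VIRTUAL KERNEL TRIPLE of the base is `(u, w, γ) ∈ 𝔽₂^{k+1} × 𝔽₂^{k+1} × 𝔽₂`
with `(L + D_m)u + D_d w = γ m` and `L(u + w) + D_d w = 0` (⇔ `D_m u + L w = γ m`) — in w3 g20's language, the kernel of Monsky's matrix of the base
twisted by the Heegner-forced virtual prime (class `7 (8)`, symbols `(−1/P_b)`), whose dimension is `s*`. If the Heegner check holds and Monsky's odd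
matrix of `(base, aux, pat)` is invertible for some mutual pattern, every linearly independent family of virtual kernel triples has
`#ι + 2 ≤ 2t`: **`t ≥ s*/2 + 1`**, for ANY pattern and ANY classes.

THE MECHANISM (memo PATTERN-FREE-MECHANISM-w3g20 §3, PATTERN-FREE-STRUCTURE-w3g21 §3). Lift a triple to `z = ((u, γ·1_Q), (u + w, 0_Q))`: the base
rows of `M z` vanish, the auxiliary rows are pattern-independent (`γ + γ = 0`), and the two auxiliary row-sums vanish (Heegner: column parities,
«odd number of `q ≡ 3 (4)`», «even number of `q ≡ ±3 (8)`» — `xorFold_negTwo_aux`). So `M` maps the `s*`-space injectively into the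
`(2t−2)`-space of vectors supported on the auxiliary rows with both row-sums zero.

HONEST FRAMING: NECESSARY condition only; RUNG-LEVEL corner layer; the crux (C⁺), its stubs and BSD untouched; nothing closed. THEOREMS ONLY.
Reference: [HeathBrown1994] appendix (Monsky), typescript pp. 39–41.
-/

namespace Summit.BirchSwinnertonDyer.BirchSwinnertonDyer.Theorems.SymbolicMonsky

open Matrix

section AuxLowerBoundSelmer

variable {k : ℕ} (base : SymbData (k + 1)) (aux : List AuxCell) (pat : ℕ → ℕ → Bool)

/-! ## §1 «Even number of auxiliary primes ≡ ±3 (mod 8)» from the Heegner check -/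

/-- `[(2/·) = −1]` on odd residues as a Boolean of `n mod 8`. -/
private theorem negTwo_mul_odd (m n : ℕ) (hm : m % 2 = 1) (hn : n % 2 = 1) :
    decide (m * n % 8 = 3 ∨ m * n % 8 = 5) = xor (decide (m % 8 = 3 ∨ m % 8 = 5)) (decide (n % 8 = 3 ∨ n % 8 = 5)) := by
  have hm8 : m % 8 = 1 ∨ m % 8 = 3 ∨ m % 8 = 5 ∨ m % 8 = 7 := by omega
  have hn8 : n % 8 = 1 ∨ n % 8 = 3 ∨ n % 8 = 5 ∨ n % 8 = 7 := by omega
  rw [Nat.mul_mod]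
  rcases hm8 with h | h | h | h <;> rcases hn8 with h' | h' | h' | h' <;> simp [h, h']

/-- The product of the cell classes is odd. -/
private theorem prod_clsVal_odd (L : List AuxCell) : (L.map fun c => clsVal c.1).prod % 2 = 1 := by
  induction L with
  | nil => simp
  | cons a L ih =>
    rw [List.map_cons, List.prod_cons, Nat.mul_mod, ih]
    have : ∀ c : Fin 4, clsVal c % 2 = 1 := by decide
    rw [this]

/-- The parity of the number of classes `≡ ±3 (8)` is read off the product mod `8`. -/
theorem negTwo_prod_eq (L : List AuxCell) :
    decide ((L.map fun c => clsVal c.1).prod % 8 = 3 ∨ (L.map fun c => clsVal c.1).prod % 8 = 5) = xorFold L (fun c => negTwo c.1) := by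
  induction L with
  | nil => simp [xorFold_nil]
  | cons a L ih =>
    have hodd : ∀ c : Fin 4, clsVal c % 2 = 1 := by decide
    have hcls : ∀ c : Fin 4, decide (clsVal c % 8 = 3 ∨ clsVal c % 8 = 5) = negTwo c := by decide
    rw [List.map_cons, List.prod_cons, xorFold_cons, negTwo_mul_odd _ _ (hodd a.1) (prod_clsVal_odd L), hcls, ih]

/-- Under the Heegner check the number of auxiliary cells of class `≡ ±3 (mod 8)` is even. -/
theorem xorFold_negTwo_aux (hh : heegnerK base aux = true) : xorFold aux (fun c => negTwo c.1) = false := by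
  have h8 := (heegnerK_spec hh).2.1
  rw [← negTwo_prod_eq, h8]
  decide

/-- In `𝔽₂`: `∑_j bz [q_j ≡ ±3 (8)] = 0`. -/
theorem sum_bz_negTwo_aux (hh : heegnerK base aux = true) :
    (∑ j : Fin aux.length, bz (negTwo (aux.getD j.val (0, 0)).1)) = 0 := by
  rw [sum_univ_bz, xorFold_aux_eq aux (fun c => negTwo c.1), xorFold_negTwo_aux base aux hh]; rfl

/-- `∑_j ∑_b bz[(P_b/q_j) = −1] = 0` (the all-ones instance of `sum_eta'_eq_zero`). -/
theorem sum_sum_bz_neg_eq_zero (hh : heegnerK base aux = true) :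
    (∑ j : Fin aux.length, ∑ b : Fin (k + 1), bz ((dataK base aux pat).neg (Fin.natAdd (k + 1) j) (Fin.castAdd aux.length b))) = 0 := by
  have h := sum_eta'_eq_zero base aux pat hh (fun _ => 1)
  simpa using h

/-- `(2 : 𝔽₂) = 0`. -/
private theorem two_eq_zero' : (2 : ZMod 2) = 0 := by decide

/-! ## §2 The lifted virtual-kernel vector and the action of Monsky's matrix on it -/

/-- Base rows, half one: for a virtual kernel triple, `(M z)_(inl b) = 0`, `z = ((u, γ1), (u+w, 0))`. -/
theorem mulVec_lift_inl_castAdd (hh : heegnerK base aux = true) (u w : Fin (k + 1) → ZMod 2) (γ : ZMod 2)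
    (hE1 : ∀ b, (∑ b' : Fin (k + 1), bz (base.neg b b') * (u b' + u b)) + bz (negNegOne (base.cls b)) * u b +
      bz (negTwo (base.cls b)) * w b + γ * bz (negNegOne (base.cls b)) = 0) (b : Fin (k + 1)) :
    ((dataK base aux pat).monskyOddS *ᵥ Sum.elim (Fin.append u (fun _ : Fin aux.length => γ))
        (Fin.append (u + w) (0 : Fin aux.length → ZMod 2))) (Sum.inl (Fin.castAdd aux.length b)) = 0 := by
  rw [SymbData.monskyOddS_mulVec_inl]
  simp only [Sum.elim_inl, Sum.elim_inr, Fin.append_left, Pi.add_apply, RealisesK.dataK_cls_castAdd]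
  rw [Fin.sum_univ_add]
  simp only [Fin.append_left, Fin.append_right, dataK_neg_castAdd_castAdd, dataK_neg_castAdd_natAdd]
  rw [← Finset.sum_mul, sum_bz_cellBit_eq base aux hh b]
  linear_combination (hE1 b) + (bz (negTwo (base.cls b)) * u b) * two_eq_zero'

/-- Base rows, half two: `(M z)_(inr b) = 0`. -/
theorem mulVec_lift_inr_castAdd (hh : heegnerK base aux = true) (u w : Fin (k + 1) → ZMod 2) (γ : ZMod 2)
    (hE2 : ∀ b, (∑ b' : Fin (k + 1), bz (base.neg b b') * ((u b' + w b') + (u b + w b))) + bz (negTwo (base.cls b)) * w b = 0)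
    (b : Fin (k + 1)) :
    ((dataK base aux pat).monskyOddS *ᵥ Sum.elim (Fin.append u (fun _ : Fin aux.length => γ))
        (Fin.append (u + w) (0 : Fin aux.length → ZMod 2))) (Sum.inr (Fin.castAdd aux.length b)) = 0 := by
  rw [SymbData.monskyOddS_mulVec_inr]
  simp only [Sum.elim_inl, Sum.elim_inr, Fin.append_left, Pi.add_apply, RealisesK.dataK_cls_castAdd]
  rw [Fin.sum_univ_add]
  simp only [Fin.append_left, Fin.append_right, Pi.add_apply, Pi.zero_apply, zero_add, dataK_neg_castAdd_castAdd,
    dataK_neg_castAdd_natAdd]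
  rw [← Finset.sum_mul, sum_bz_cellBit_eq base aux hh b]
  linear_combination (hE2 b) + (u b + w b) * bz_negNegOne_add_bz_negNegTwo (base.cls b) +
    (bz (negTwo (base.cls b)) * u b) * two_eq_zero'

/-- Auxiliary rows, half one: `(M z)_(inl q_j) = ∑_b bz[(P_b/q_j)=−1](u_b + γ) + bz[(2/q_j)=−1]·γ` — pattern-independent. -/
theorem mulVec_lift_inl_natAdd (u w : Fin (k + 1) → ZMod 2) (γ : ZMod 2) (j : Fin aux.length) :
    ((dataK base aux pat).monskyOddS *ᵥ Sum.elim (Fin.append u (fun _ : Fin aux.length => γ))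
        (Fin.append (u + w) (0 : Fin aux.length → ZMod 2))) (Sum.inl (Fin.natAdd (k + 1) j)) =
      (∑ b : Fin (k + 1), bz ((dataK base aux pat).neg (Fin.natAdd (k + 1) j) (Fin.castAdd aux.length b)) * (u b + γ)) +
        bz (negTwo (aux.getD j.val (0, 0)).1) * γ := by
  rw [SymbData.monskyOddS_mulVec_inl]
  simp only [Sum.elim_inl, Sum.elim_inr, Fin.append_right, Pi.zero_apply, add_zero, RealisesK.dataK_cls_natAdd]
  rw [Fin.sum_univ_add]
  simp only [Fin.append_left, Fin.append_right, zmod_two_add_self, mul_zero, Finset.sum_const_zero, add_zero]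

/-- Auxiliary rows, half two: `(M z)_(inr q_j) = bz[(2/q_j)=−1]·γ + ∑_b bz[(P_b/q_j)=−1](u_b + w_b)` — pattern-independent. -/
theorem mulVec_lift_inr_natAdd (u w : Fin (k + 1) → ZMod 2) (γ : ZMod 2) (j : Fin aux.length) :
    ((dataK base aux pat).monskyOddS *ᵥ Sum.elim (Fin.append u (fun _ : Fin aux.length => γ))
        (Fin.append (u + w) (0 : Fin aux.length → ZMod 2))) (Sum.inr (Fin.natAdd (k + 1) j)) =
      bz (negTwo (aux.getD j.val (0, 0)).1) * γ +
        ∑ b : Fin (k + 1), bz ((dataK base aux pat).neg (Fin.natAdd (k + 1) j) (Fin.castAdd aux.length b)) * (u b + w b) := by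
  rw [SymbData.monskyOddS_mulVec_inr]
  simp only [Sum.elim_inl, Sum.elim_inr, Fin.append_right, Pi.zero_apply, add_zero, mul_zero, RealisesK.dataK_cls_natAdd]
  rw [Fin.sum_univ_add]
  simp only [Fin.append_left, Fin.append_right, Pi.add_apply, Pi.zero_apply, mul_zero, Finset.sum_const_zero, add_zero]

/-! ## §3 The Selmer bound -/

/-- ★ **LOWER BOUND («t ≥ t₀ = s*/2 + 1»).** If the Heegner check holds and Monsky's odd matrix of `(base, aux, pat)` is invertible for some mutual
pattern, every linearly independent family of VIRTUAL KERNEL TRIPLES `(u, w, γ)` of the base (`(L+D_m)u + D_d w = γm`, `L(u+w) + D_d w = 0`, written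
out with the base's completed symbols and classes) has `#ι + 2 ≤ 2t`. For ANY pattern and ANY classes of the auxiliary primes.
[cite: HeathBrown1994SelmerCongruentII, Appendix (Monsky), typescript p. 39 L27–L33] -/
theorem card_add_two_le_two_mul_length_of_virtualKernel (hh : heegnerK base aux = true)
    (hdet : (dataK base aux pat).monskyOddS.det = 1) {ι : Type*} [Fintype ι]
    (f : ι → (Fin (k + 1) → ZMod 2) × (Fin (k + 1) → ZMod 2) × ZMod 2)
    (hE1 : ∀ i b, (∑ b' : Fin (k + 1), bz (base.neg b b') * ((f i).1 b' + (f i).1 b)) + bz (negNegOne (base.cls b)) * (f i).1 b +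
      bz (negTwo (base.cls b)) * (f i).2.1 b + (f i).2.2 * bz (negNegOne (base.cls b)) = 0)
    (hE2 : ∀ i b, (∑ b' : Fin (k + 1), bz (base.neg b b') * (((f i).1 b' + (f i).2.1 b') + ((f i).1 b + (f i).2.1 b))) +
      bz (negTwo (base.cls b)) * (f i).2.1 b = 0)
    (hf : LinearIndependent (ZMod 2) f) :
    Fintype.card ι + 2 ≤ 2 * aux.length := by
  classical
  set t := aux.length with ht
  set d := dataK base aux pat with hd'
  have ht0 : 0 < t := (heegnerK_spec hh).1
  set N : Fin t → Fin (k + 1) → ZMod 2 := fun j b => bz (d.neg (Fin.natAdd (k + 1) j) (Fin.castAdd t b)) with hN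
  set dq : Fin t → ZMod 2 := fun j => bz (negTwo (aux.getD j.val (0, 0)).1) with hdq
  -- the base equations as a linear map `E`, and the auxiliary rows as a linear map `Φ`
  let E : ((Fin (k + 1) → ZMod 2) × (Fin (k + 1) → ZMod 2) × ZMod 2) →ₗ[ZMod 2]
      ((Fin (k + 1) → ZMod 2) × (Fin (k + 1) → ZMod 2)) :=
    { toFun := fun x =>
        (fun b => (∑ b' : Fin (k + 1), bz (base.neg b b') * (x.1 b' + x.1 b)) + bz (negNegOne (base.cls b)) * x.1 b +
            bz (negTwo (base.cls b)) * x.2.1 b + x.2.2 * bz (negNegOne (base.cls b)),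
         fun b => (∑ b' : Fin (k + 1), bz (base.neg b b') * ((x.1 b' + x.2.1 b') + (x.1 b + x.2.1 b))) +
            bz (negTwo (base.cls b)) * x.2.1 b)
      map_add' := by
        intro x y
        refine Prod.ext (funext fun b => ?_) (funext fun b => ?_)
        · simp only [Prod.fst_add, Prod.snd_add, Pi.add_apply]
          rw [show (∑ b' : Fin (k + 1), bz (base.neg b b') * ((x.1 b' + y.1 b') + (x.1 b + y.1 b))) =
              (∑ b' : Fin (k + 1), bz (base.neg b b') * (x.1 b' + x.1 b)) +
                ∑ b' : Fin (k + 1), bz (base.neg b b') * (y.1 b' + y.1 b) from by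
            rw [← Finset.sum_add_distrib]; exact Finset.sum_congr rfl fun _ _ => by ring]
          ring
        · simp only [Prod.fst_add, Prod.snd_add, Pi.add_apply]
          rw [show (∑ b' : Fin (k + 1), bz (base.neg b b') * ((x.1 b' + y.1 b' + (x.2.1 b' + y.2.1 b')) +
              (x.1 b + y.1 b + (x.2.1 b + y.2.1 b)))) =
              (∑ b' : Fin (k + 1), bz (base.neg b b') * ((x.1 b' + x.2.1 b') + (x.1 b + x.2.1 b))) +
                ∑ b' : Fin (k + 1), bz (base.neg b b') * ((y.1 b' + y.2.1 b') + (y.1 b + y.2.1 b)) from by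
            rw [← Finset.sum_add_distrib]; exact Finset.sum_congr rfl fun _ _ => by ring]
          ring
      map_smul' := by
        intro c x
        refine Prod.ext (funext fun b => ?_) (funext fun b => ?_)
        · simp only [Prod.smul_fst, Prod.smul_snd, Pi.smul_apply, smul_eq_mul, RingHom.id_apply]
          rw [show (∑ b' : Fin (k + 1), bz (base.neg b b') * (c * x.1 b' + c * x.1 b)) =
              c * ∑ b' : Fin (k + 1), bz (base.neg b b') * (x.1 b' + x.1 b) from by
            rw [Finset.mul_sum]; exact Finset.sum_congr rfl fun _ _ => by ring]
          ring
        · simp only [Prod.smul_fst, Prod.smul_snd, Pi.smul_apply, smul_eq_mul, RingHom.id_apply]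
          rw [show (∑ b' : Fin (k + 1), bz (base.neg b b') * ((c * x.1 b' + c * x.2.1 b') + (c * x.1 b + c * x.2.1 b))) =
              c * ∑ b' : Fin (k + 1), bz (base.neg b b') * ((x.1 b' + x.2.1 b') + (x.1 b + x.2.1 b)) from by
            rw [Finset.mul_sum]; exact Finset.sum_congr rfl fun _ _ => by ring]
          ring }
  have hE1' : ∀ x, ∀ b, (E x).1 b = (∑ b' : Fin (k + 1), bz (base.neg b b') * (x.1 b' + x.1 b)) +
      bz (negNegOne (base.cls b)) * x.1 b + bz (negTwo (base.cls b)) * x.2.1 b + x.2.2 * bz (negNegOne (base.cls b)) :=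
    fun x b => rfl
  have hE2' : ∀ x, ∀ b, (E x).2 b = (∑ b' : Fin (k + 1), bz (base.neg b b') * ((x.1 b' + x.2.1 b') + (x.1 b + x.2.1 b))) +
      bz (negTwo (base.cls b)) * x.2.1 b := fun x b => rfl
  let Φ : ((Fin (k + 1) → ZMod 2) × (Fin (k + 1) → ZMod 2) × ZMod 2) →ₗ[ZMod 2] ((Fin t → ZMod 2) × (Fin t → ZMod 2)) :=
    { toFun := fun x => (fun j => (∑ b, N j b * (x.1 b + x.2.2)) + dq j * x.2.2,
                        fun j => dq j * x.2.2 + ∑ b, N j b * (x.1 b + x.2.1 b))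
      map_add' := by
        intro x y
        refine Prod.ext (funext fun j => ?_) (funext fun j => ?_)
        · simp only [Prod.fst_add, Prod.snd_add, Pi.add_apply]
          rw [show (∑ b, N j b * ((x.1 b + y.1 b) + (x.2.2 + y.2.2))) =
              (∑ b, N j b * (x.1 b + x.2.2)) + ∑ b, N j b * (y.1 b + y.2.2) from by
            rw [← Finset.sum_add_distrib]; exact Finset.sum_congr rfl fun _ _ => by ring]
          ring
        · simp only [Prod.fst_add, Prod.snd_add, Pi.add_apply]
          rw [show (∑ b, N j b * ((x.1 b + y.1 b) + (x.2.1 b + y.2.1 b))) =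
              (∑ b, N j b * (x.1 b + x.2.1 b)) + ∑ b, N j b * (y.1 b + y.2.1 b) from by
            rw [← Finset.sum_add_distrib]; exact Finset.sum_congr rfl fun _ _ => by ring]
          ring
      map_smul' := by
        intro c x
        refine Prod.ext (funext fun j => ?_) (funext fun j => ?_)
        · simp only [Prod.smul_fst, Prod.smul_snd, Pi.smul_apply, smul_eq_mul, RingHom.id_apply]
          rw [show (∑ b, N j b * (c * x.1 b + c * x.2.2)) = c * ∑ b, N j b * (x.1 b + x.2.2) from by
            rw [Finset.mul_sum]; exact Finset.sum_congr rfl fun _ _ => by ring]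
          ring
        · simp only [Prod.smul_fst, Prod.smul_snd, Pi.smul_apply, smul_eq_mul, RingHom.id_apply]
          rw [show (∑ b, N j b * (c * x.1 b + c * x.2.1 b)) = c * ∑ b, N j b * (x.1 b + x.2.1 b) from by
            rw [Finset.mul_sum]; exact Finset.sum_congr rfl fun _ _ => by ring]
          ring }
  have hΦ1 : ∀ x, ∀ j, (Φ x).1 j = (∑ b, N j b * (x.1 b + x.2.2)) + dq j * x.2.2 := fun x j => rfl
  have hΦ2 : ∀ x, ∀ j, (Φ x).2 j = dq j * x.2.2 + ∑ b, N j b * (x.1 b + x.2.1 b) := fun x j => rfl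
  -- Φ is injective on ker E (virtual kernel triples)
  have hinj : ∀ x, E x = 0 → Φ x = 0 → x = 0 := by
    intro x hEx hΦx
    have h1 : ∀ b, (∑ b' : Fin (k + 1), bz (base.neg b b') * (x.1 b' + x.1 b)) + bz (negNegOne (base.cls b)) * x.1 b +
        bz (negTwo (base.cls b)) * x.2.1 b + x.2.2 * bz (negNegOne (base.cls b)) = 0 := fun b => by
      rw [← hE1' x b, hEx]; rfl
    have h2 : ∀ b, (∑ b' : Fin (k + 1), bz (base.neg b b') * ((x.1 b' + x.2.1 b') + (x.1 b + x.2.1 b))) +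
        bz (negTwo (base.cls b)) * x.2.1 b = 0 := fun b => by
      rw [← hE2' x b, hEx]; rfl
    set z : Fin (k + 1 + t) ⊕ Fin (k + 1 + t) → ZMod 2 :=
      Sum.elim (Fin.append x.1 (fun _ : Fin t => x.2.2)) (Fin.append (x.1 + x.2.1) (0 : Fin t → ZMod 2)) with hz
    have hMz : d.monskyOddS *ᵥ z = 0 := by
      funext idx
      rcases idx with i | i
      · refine Fin.addCases (fun b => ?_) (fun j => ?_) i
        · exact mulVec_lift_inl_castAdd base aux pat hh x.1 x.2.1 x.2.2 h1 b
        · rw [Pi.zero_apply, mulVec_lift_inl_natAdd base aux pat x.1 x.2.1 x.2.2 j]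
          have := congrFun (congrArg Prod.fst hΦx) j
          rw [hΦ1] at this
          exact this
      · refine Fin.addCases (fun b => ?_) (fun j => ?_) i
        · exact mulVec_lift_inr_castAdd base aux pat hh x.1 x.2.1 x.2.2 h2 b
        · rw [Pi.zero_apply, mulVec_lift_inr_natAdd base aux pat x.1 x.2.1 x.2.2 j]
          have := congrFun (congrArg Prod.snd hΦx) j
          rw [hΦ2] at this
          exact this
    have hz0 : z = 0 := by
      by_contra hne
      have : d.monskyOddS.det = 0 := Matrix.exists_mulVec_eq_zero_iff.mp ⟨z, hne, hMz⟩
      rw [hdet] at this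
      exact one_ne_zero this
    have hu : x.1 = 0 := by
      funext b
      have := congrFun hz0 (Sum.inl (Fin.castAdd t b))
      simp only [hz, Sum.elim_inl, Fin.append_left, Pi.zero_apply] at this
      rw [this, Pi.zero_apply]
    have hγ : x.2.2 = 0 := by
      have := congrFun hz0 (Sum.inl (Fin.natAdd (k + 1) ⟨0, ht0⟩))
      simp only [hz, Sum.elim_inl, Fin.append_right, Pi.zero_apply] at this
      exact this
    have hw : x.2.1 = 0 := by
      funext b
      have := congrFun hz0 (Sum.inr (Fin.castAdd t b))
      simp only [hz, Sum.elim_inr, Fin.append_left, Pi.add_apply, Pi.zero_apply] at this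
      rw [hu, Pi.zero_apply, zero_add] at this
      rw [this, Pi.zero_apply]
    exact Prod.ext hu (Prod.ext hw hγ)
  -- every f i lies in ker E
  have hEf : ∀ i, E (f i) = 0 := fun i =>
    Prod.ext (funext fun b => by rw [hE1']; exact hE1 i b) (funext fun b => by rw [hE2']; exact hE2 i b)
  -- the family Φ ∘ f is linearly independent
  have hΦf : LinearIndependent (ZMod 2) (fun i => Φ (f i)) := by
    rw [linearIndependent_iff'] at hf ⊢
    intro s g hg i hi
    have hsum : Φ (∑ i ∈ s, g i • f i) = 0 := by
      rw [map_sum]; simpa only [map_smul] using hg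
    have hEsum : E (∑ i ∈ s, g i • f i) = 0 := by
      rw [map_sum]
      exact Finset.sum_eq_zero fun i _ => by rw [map_smul, hEf i, smul_zero]
    exact hf s g (hinj _ hEsum hsum) i hi
  -- Φ ∘ f lands in the kernel of the two row-sum functionals
  let ψ : ((Fin t → ZMod 2) × (Fin t → ZMod 2)) →ₗ[ZMod 2] (ZMod 2 × ZMod 2) :=
    ((∑ j : Fin t, LinearMap.proj j).comp (LinearMap.fst (ZMod 2) (Fin t → ZMod 2) (Fin t → ZMod 2))).prod
      ((∑ j : Fin t, LinearMap.proj j).comp (LinearMap.snd (ZMod 2) (Fin t → ZMod 2) (Fin t → ZMod 2)))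
  have hψ_apply : ∀ v : (Fin t → ZMod 2) × (Fin t → ZMod 2), ψ v = (∑ j, v.1 j, ∑ j, v.2 j) := by
    intro v; simp [ψ]
  have hmem : ∀ i, Φ (f i) ∈ LinearMap.ker ψ := by
    intro i
    rw [LinearMap.mem_ker, hψ_apply, Prod.mk_eq_zero]
    constructor
    · simp only [hΦ1]
      rw [Finset.sum_add_distrib, ← Finset.sum_mul, sum_bz_negTwo_aux base aux hh, zero_mul, add_zero]
      simp only [mul_add, Finset.sum_add_distrib]
      have hA : (∑ x : Fin t, ∑ b : Fin (k + 1), N x b * (f i).1 b) = 0 := by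
        simp only [hN]; exact sum_eta'_eq_zero base aux pat hh (f i).1
      have hB : (∑ x : Fin t, ∑ b : Fin (k + 1), N x b * (f i).2.2) = 0 := by
        rw [show (∑ x : Fin t, ∑ b : Fin (k + 1), N x b * (f i).2.2) = (∑ x : Fin t, ∑ b : Fin (k + 1), N x b) * (f i).2.2 from by
          rw [Finset.sum_mul]; exact Finset.sum_congr rfl fun _ _ => by rw [Finset.sum_mul]]
        have h0 : (∑ x : Fin t, ∑ b : Fin (k + 1), N x b) = 0 := by
          simp only [hN]; exact sum_sum_bz_neg_eq_zero base aux pat hh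
        rw [h0, zero_mul]
      rw [hA, hB, add_zero]
    · simp only [hΦ2]
      rw [Finset.sum_add_distrib, ← Finset.sum_mul, sum_bz_negTwo_aux base aux hh, zero_mul, zero_add]
      exact sum_eta'_eq_zero base aux pat hh ((f i).1 + (f i).2.1)
  have hΦf' : LinearIndependent (ZMod 2) (fun i => (⟨Φ (f i), hmem i⟩ : LinearMap.ker ψ)) := by
    apply LinearIndependent.of_comp (LinearMap.ker ψ).subtype
    exact hΦf
  have hcard := hΦf'.fintype_card_le_finrank
  -- dim ker ψ = 2t − 2
  have hsurj : Function.Surjective ψ := by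
    intro c
    refine ⟨(Pi.single (⟨0, ht0⟩ : Fin t) c.1, Pi.single (⟨0, ht0⟩ : Fin t) c.2), ?_⟩
    rw [hψ_apply]
    simp
  have hrange : Module.finrank (ZMod 2) (LinearMap.range ψ) = 2 := by
    rw [LinearMap.range_eq_top.mpr hsurj, finrank_top]
    simp
  have hrn := LinearMap.finrank_range_add_finrank_ker ψ
  rw [hrange] at hrn
  have hWW : Module.finrank (ZMod 2) ((Fin t → ZMod 2) × (Fin t → ZMod 2)) = 2 * t := by
    rw [Module.finrank_prod, Module.finrank_fintype_fun_eq_card, Fintype.card_fin]; ring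
  omega

/-! ## §4 Example: a base where only the Selmer bound is sharp -/

/-- Base `p ≡ 7 (8)`, `r₁ ≡ r₂ ≡ 5 (8)`, `(r₁/p) = (r₂/p) = +1`, `(r₂/r₁) = −1` (`k = 2`): the three coordinate-plane kernels have dimension `≤ 1`
(so `…AuxLowerBound(Twins)` give only `t ≥ 2`), but the virtual kernel has dimension `s* = 4` — spanned by `(e₀,0,1)`, `(e₁,e₁+e₂,0)`,
`(e₂,e₁+e₂,0)`, `(0,e₀,0)` — so every winning Heegner recipe has `t ≥ 3 = t₀` (census: pattern-free recipes with `t = 3` exist). -/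
theorem three_le_length_of_example (aux : List AuxCell) (pat : ℕ → ℕ → Bool)
    (hh : heegnerK (⟨![3, 2, 2], fun i j => decide (i.val = 1 ∧ j.val = 2)⟩ : SymbData 3) aux = true)
    (hdet : (dataK (⟨![3, 2, 2], fun i j => decide (i.val = 1 ∧ j.val = 2)⟩ : SymbData 3) aux pat).monskyOddS.det = 1) :
    3 ≤ aux.length := by
  have h := card_add_two_le_two_mul_length_of_virtualKernel (⟨![3, 2, 2], fun i j => decide (i.val = 1 ∧ j.val = 2)⟩ : SymbData 3)
    aux pat hh hdet
    (![(Pi.single 0 1, 0, 1), (Pi.single 1 1, Pi.single 1 1 + Pi.single 2 1, 0), (Pi.single 2 1, Pi.single 1 1 + Pi.single 2 1, 0),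
      (0, Pi.single 0 1, 0)] : Fin 4 → (Fin 3 → ZMod 2) × (Fin 3 → ZMod 2) × ZMod 2)
    (by decide) (by decide) (Fintype.linearIndependent_iff.mpr (by decide))
  simp only [Fintype.card_fin] at h
  omega

end AuxLowerBoundSelmer

end Summit.BirchSwinnertonDyer.BirchSwinnertonDyer.Theorems.SymbolicMonsky
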